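import Summits.Ventures.CertifiedArithmetic.LowPrec.DoubleRounding
import Summits.Ventures.CertifiedArithmetic.LowPrec.AccumulateTree
import Summits.Ventures.CertifiedArithmetic.LowPrec.GemmDirectedChains

/-!
# Accumulating through a wide adder equals accumulating in the narrow format (any order)

HONEST FRAMING (venture CertifiedArithmetic / cell `pub-lowprec`): certified error envelopes and
provably optimal rounding/accumulation schemes for low-precision formats under stated cost models;
every table by two implementations; no hardware or vendor claims.

Consequence of the double rounding theorem (`DoubleRounding.lean`) for whole accumulations: if every
addition of an evaluation tree is performed in a wide format `ψ` and its result immediately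
converted to (stored in) the narrow format `φ` — node operation `z ↦ fl_φ(fl_ψ(z))` — then, for
leaves in `F_φ` and formats with `2·m_φ + 2 ≤ m_ψ`, `bias_φ ≤ bias_ψ`, `maxRat φ ≤ maxRat ψ`, the
computed value at EVERY node equals that of the same tree evaluated purely in `φ`
(`MiniFloat.eval_wide_then_narrow_eq`); likewise for the recursive order in the cell's `seqSumWith`
vocabulary (`MiniFloat.seqSumWith_wide_then_narrow_eq_seqSum`). Hence every envelope, table and
witness of the cell for accumulation in `φ` (sequential, pairwise, blocked; `Accumulate*.lean`,
the GEMM note's bfloat16/binary16 rows) applies VERBATIM to "`ψ` adder, `φ` storage" pipelines: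
bfloat16 or binary16 storage with a binary32 adder, FP8 storage with a binary16 or binary32 adder
(instances below). Not covered (hypotheses fail, and the statement is false): `E4M3` storage with
a bfloat16 adder, bfloat16 storage with a binary16 adder (`DoubleRoundingVerdicts.lean`).
-/

namespace Literature.ComputerArithmetic.FloatingPoint

namespace MiniFloat

open Literature.ComputerArithmetic.JeannerodRump2018

variable {φ ψ : Format}

/-- A subtree evaluated in `φ` from leaves in `F_φ` is a value of `φ` (leaf: hypothesis; node: a
rounding). [folklore] -/
theorem exists_toRat_eq_eval_of_leaves (t : SumTree)
    (ht : ∀ x ∈ t.leaves, ∃ y : MiniFloat φ, y.toRat = x) :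
    ∃ y : MiniFloat φ, y.toRat = SumTree.eval (flα φ) t := by
  cases t with
  | leaf x => exact ht x (by simp [SumTree.leaves])
  | node _ _ => exact ⟨roundNE φ _, rfl⟩

/-- ANY EVALUATION ORDER: with leaves in `F_φ`, evaluating a tree with the node operation
`fl_φ ∘ fl_ψ` (add in `ψ`, store in `φ`) gives the same value as evaluating it with `fl_φ`, at the
root and hence at every node. [cite: Figueroa1995, §2] -/
theorem eval_wide_then_narrow_eq (hm : 2 * φ.manBits + 2 ≤ ψ.manBits) (hb : φ.bias ≤ ψ.bias)
    (hmax : φ.maxRat ≤ ψ.maxRat) :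
    ∀ t : SumTree, (∀ x ∈ t.leaves, ∃ y : MiniFloat φ, y.toRat = x) →
      SumTree.eval (fun z => flα φ (flα ψ z)) t = SumTree.eval (flα φ) t
  | .leaf x, _ => rfl
  | .node l r, ht => by
      have hl : ∀ x ∈ l.leaves, ∃ y : MiniFloat φ, y.toRat = x :=
        fun x hx => ht x (by simp [SumTree.leaves, hx])
      have hr : ∀ x ∈ r.leaves, ∃ y : MiniFloat φ, y.toRat = x :=
        fun x hx => ht x (by simp [SumTree.leaves, hx])
      simp only [SumTree.eval]
      rw [eval_wide_then_narrow_eq hm hb hmax l hl, eval_wide_then_narrow_eq hm hb hmax r hr]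
      obtain ⟨a, ha⟩ := exists_toRat_eq_eval_of_leaves l hl
      obtain ⟨b, hb'⟩ := exists_toRat_eq_eval_of_leaves r hr
      rw [← ha, ← hb']
      exact toRat_roundNE_roundNE_add hm hb hmax a b

/-- RECURSIVE ORDER in the cell's `seqSumWith` vocabulary: accumulating `x 0, …, x k ∈ F_φ` with
the step `z ↦ fl_φ(fl_ψ(z))` gives the same values as `seqSum φ` (pure `φ` accumulation).
[cite: Figueroa1995, §2] -/
theorem seqSumWith_wide_then_narrow_eq_seqSum (hm : 2 * φ.manBits + 2 ≤ ψ.manBits)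
    (hb : φ.bias ≤ ψ.bias) (hmax : φ.maxRat ≤ ψ.maxRat) (x : ℕ → ℚ) :
    ∀ k, (∀ i ≤ k, ∃ y : MiniFloat φ, y.toRat = x i) →
      (seqSumWith (fun z => roundNE φ (roundNE ψ z).toRat) x k).toRat = (seqSum φ x k).toRat
  | 0, hx => by
      simp only [seqSumWith, seqSum]
      exact toRat_roundNE_roundNE_of_exists (by
        obtain ⟨y, hy⟩ := hx 0 le_rfl
        obtain ⟨z, hz⟩ := exists_toRat_eq_of_le (by omega) (qexp_le_of_le (by omega) hb) hmax y
        exact ⟨z, hz.trans hy⟩)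
  | k + 1, hx => by
      simp only [seqSumWith, seqSum]
      rw [seqSumWith_wide_then_narrow_eq_seqSum hm hb hmax x k (fun i hi => hx i (Nat.le_succ_of_le hi))]
      obtain ⟨b, hb'⟩ := hx (k + 1) le_rfl
      rw [← hb']
      exact toRat_roundNE_roundNE_add hm hb hmax (seqSum φ x k) b

/-! ### Instances -/

/-- bfloat16 storage, binary32 adder: any evaluation tree with bfloat16 leaves. [folklore] -/
theorem eval_Binary32_then_BFloat16_eq (t : SumTree)
    (ht : ∀ x ∈ t.leaves, ∃ y : MiniFloat Format.BFloat16, y.toRat = x) :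
    SumTree.eval (fun z => flα Format.BFloat16 (flα Format.Binary32 z)) t
      = SumTree.eval (flα Format.BFloat16) t :=
  eval_wide_then_narrow_eq (by decide) (by decide) (by decide +kernel) t ht

/-- binary16 storage, binary32 adder: any evaluation tree with binary16 leaves. [folklore] -/
theorem eval_Binary32_then_Binary16_eq (t : SumTree)
    (ht : ∀ x ∈ t.leaves, ∃ y : MiniFloat Format.Binary16, y.toRat = x) :
    SumTree.eval (fun z => flα Format.Binary16 (flα Format.Binary32 z)) t
      = SumTree.eval (flα Format.Binary16) t :=
  eval_wide_then_narrow_eq (by decide) (by decide) (by decide +kernel) t ht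

/-- `E5M2` storage, binary16 adder: any evaluation tree with `E5M2` leaves. [folklore] -/
theorem eval_Binary16_then_E5M2_eq (t : SumTree)
    (ht : ∀ x ∈ t.leaves, ∃ y : MiniFloat Format.E5M2, y.toRat = x) :
    SumTree.eval (fun z => flα Format.E5M2 (flα Format.Binary16 z)) t
      = SumTree.eval (flα Format.E5M2) t :=
  eval_wide_then_narrow_eq (by decide) (by decide) (by decide +kernel) t ht

/-- `E4M3` storage, binary16 adder: any evaluation tree with `E4M3` leaves. [folklore] -/
theorem eval_Binary16_then_E4M3_eq (t : SumTree)
    (ht : ∀ x ∈ t.leaves, ∃ y : MiniFloat Format.E4M3, y.toRat = x) :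
    SumTree.eval (fun z => flα Format.E4M3 (flα Format.Binary16 z)) t
      = SumTree.eval (flα Format.E4M3) t :=
  eval_wide_then_narrow_eq (by decide) (by decide) (by decide +kernel) t ht

/-- bfloat16 storage, binary32 adder, recursive order: `ŝₖ` agree with pure bfloat16 `seqSum`.
[folklore] -/
theorem seqSum_Binary32_then_BFloat16_eq (x : ℕ → ℚ) (k : ℕ)
    (hx : ∀ i ≤ k, ∃ y : MiniFloat Format.BFloat16, y.toRat = x i) :
    (seqSumWith (fun z => roundNE Format.BFloat16 (roundNE Format.Binary32 z).toRat) x k).toRat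
      = (seqSum Format.BFloat16 x k).toRat :=
  seqSumWith_wide_then_narrow_eq_seqSum (by decide) (by decide) (by decide +kernel) x k hx

end MiniFloat

end Literature.ComputerArithmetic.FloatingPoint
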